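import Mathlib
import Summits.NavierStokesRegularity.NavierStokesRegularity.Theorems.EulerZoomLiouvillePowerGaugeEulerLiouvilleHoopRunTools
import Summits.NavierStokesRegularity.NavierStokesRegularity.Theorems.EulerZoomLiouvillePowerGaugeEulerLiouvilleHoopPressureDrop
import HarnessLib

/-!
# Hoop core — K-TJ′ (M0): ONE straight, thin, quiet-walled, slow ∧ Bernoulli-high run against the E-budget is contradictory

Sub-problem `NavierStokesRegularity`, crux `PowerGaugeEulerLiouville` (a crux CLASS of self-similar Euler/NS strata on the
MODEL lattice — not NS regularity, not E).  Seat ns-ezl-w3 g7 (K-TJ′-PROOF file (M0); LEAD 19832 key 03:09:57Z/03:24:52Z; the face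
`HasStraightSlowHighRuns` and the bookkeeping are nsreg-p2 g39's K-TJ′ TEXT, constants checked by ns-idea-11 g9).

`false_of_straightSlowHighRun` — profile level, class-free except for ONE budget hypothesis.  Data: a `C²` profile pair
`IsSelfSimilarEulerProfile γ 0 V P` (`γ = 1/(2+ρ)`, `0 < ρ ≤ ½`); constants `Λ > 0`, `ν, K, B ≥ 0`, `λ, η` real, with the face's strict inequality
`B + 4K² + 4K < Λ·(½γ(1−γ) − ½λ² − η − ν²)`; ONE run at radius `R ≥ 1`: a rigid motion `x ↦ A x + a` carrying `solidCyl s₁ s₂ b`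
(`b = R^{−(1+ρ)}`, `s₂ − s₁ ≥ Λ b`) into the shell `R ≤ ‖·‖ ≤ 2R` with speed `‖V‖ ≤ K R` on the tube, axis SLOW (`‖W‖ ≤ λR`) and HIGH
(`ℋ ≥ h`), wall circle AMBIENT (`⟨P⟩_θ(σ,b) ≤ h + ηR²`, wall speed `≤ νR`); the E-budget on the ball `∫⁻_{‖z‖≤2R} ‖DV‖ₑ² ≤ B (2R)^{1−ρ}`;
and `R` large in the explicit sense `Λ(K/2 + γν)R^{−(2+ρ)} ≤ (Λ(½γ(1−γ) − ½λ² − η − ν²) − (B + 4K² + 4K))/2`.  Conclusion: `False`.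
Proof = the TEXT's bookkeeping: move the run to the `e_z`-axis (`…HoopRunTools` §1), apply TJ-CORE `integral_axisPressureDrop_le`
(`…HoopPressureDrop`: AX∫ + the transverse hoop inequality) on `Z = solidCyl s₁ s₂ b`; the left side is `≥ 2π L R² μ`,
`μ = ½γ(1−γ) − ½λ² − η`; the right side is `≤ 6BR²b + 4πbK²R² + πLbKR + 2πL(γb + νR)νR + 2π(2b(K+2γ)KR² + 4γbKR²)`
(`…HoopRunTools` §2–§3); dividing by `2πR²b` and using `3/π ≤ 1`, `8γ ≤ 4`, `|1−3γ| ≤ ½`, `L/b ≥ Λ` contradicts the strict inequality.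
WHAT THIS IS NOT: not NS, not E — a statement about hypothetical profiles; 19832 OPEN; NS regularity NOT proved.  [nsreg-p2 g39 K-TJ′ TEXT;
ns-idea-11 g8 HOOP NOTE §4, §8(b), §10(a)]
-/

noncomputable section

open MeasureTheory Set WithLp Metric Real Function
open scoped InnerProductSpace RealInnerProductSpace ENNReal Interval

set_option linter.dupNamespace false

namespace Summit.NavierStokesRegularity.NavierStokesRegularity.Theorems.PowerGaugeEulerLiouville.HoopCore

open Literature.Analysis Literature.Analysis.FluidPDE

/-- The axis point `s • e_z` lies in the solid cylinder `solidCyl s₁ s₂ T₀` for `s ∈ [s₁, s₂]`, `T₀ ≥ 0`. [folklore] -/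
theorem smul_eZ_mem_solidCyl {s₁ s₂ T₀ s : ℝ} (hs : s ∈ Icc s₁ s₂) (hT₀ : 0 ≤ T₀) : s • eZ ∈ solidCyl s₁ s₂ T₀ := by
  rw [← axisPt_radius_zero s 0]
  exact (axisPt_mem_solidCyl le_rfl 0).2 ⟨hs.1, hs.2, hT₀⟩

/-- `|1 − 3γ| ≤ ½` for `γ = 1/(2+ρ)`, `0 ≤ ρ ≤ ½` (`γ ∈ [2/5, 1/2]`). [folklore] -/
theorem abs_one_sub_three_mul_le {ρ : ℝ} (hρ : 0 ≤ ρ) (hρ1 : ρ ≤ 1 / 2) : |1 - 3 * (1 / (2 + ρ))| ≤ 1 / 2 := by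
  have h2 : (0 : ℝ) < 2 + ρ := by linarith
  rw [abs_le]
  constructor
  · rw [show 1 - 3 * (1 / (2 + ρ)) = (ρ - 1) / (2 + ρ) by field_simp; ring]
    rw [le_div_iff₀ h2]; linarith
  · rw [show 1 - 3 * (1 / (2 + ρ)) = (ρ - 1) / (2 + ρ) by field_simp; ring]
    rw [div_le_iff₀ h2]; linarith

/-- **K-TJ′ (M0) — ONE LONG STRAIGHT SLOW ∧ HIGH RUN CONTRADICTS THE E-BUDGET.**  See the module docstring for the data; the
conclusion is `False`.  [nsreg-p2 g39 K-TJ′ TEXT; ns-idea-11 g8 HOOP NOTE §4] -/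
theorem false_of_straightSlowHighRun {ρ : ℝ} (hρ : 0 < ρ) (hρ1 : ρ ≤ 1 / 2)
    {V : EuclideanSpace ℝ (Fin 3) → EuclideanSpace ℝ (Fin 3)} {P : EuclideanSpace ℝ (Fin 3) → ℝ}
    (hprof : IsSelfSimilarEulerProfile (1 / (2 + ρ)) 0 V P)
    {Λ lam η ν K B : ℝ} (hΛ : 0 < Λ) (hν : 0 ≤ ν) (hK : 0 ≤ K) (hB : 0 ≤ B)
    (hface : B + 4 * K ^ 2 + 4 * K < Λ * ((1 / (2 + ρ)) * (1 - 1 / (2 + ρ)) / 2 - lam ^ 2 / 2 - η - ν ^ 2))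
    {A : EuclideanSpace ℝ (Fin 3) ≃ₗᵢ[ℝ] EuclideanSpace ℝ (Fin 3)} {a : EuclideanSpace ℝ (Fin 3)} {R s₁ s₂ h : ℝ} (hR : 1 ≤ R)
    (hlen : s₁ + Λ * R ^ (-(1 + ρ)) ≤ s₂)
    (htube : ∀ x ∈ solidCyl s₁ s₂ (R ^ (-(1 + ρ))), R ≤ ‖A x + a‖ ∧ ‖A x + a‖ ≤ 2 * R ∧ ‖V (A x + a)‖ ≤ K * R)
    (haxis : ∀ σ ∈ Icc s₁ s₂, ‖selfSimilarTransport (1 / (2 + ρ)) 0 V (A (σ • eZ) + a)‖ ≤ lam * R ∧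
        h ≤ selfSimilarBernoulli (1 / (2 + ρ)) 0 V P (A (σ • eZ) + a) ∧
        circleAvg (fun x => P (A x + a)) σ (R ^ (-(1 + ρ))) ≤ h + η * R ^ 2 ∧
        ∀ θ : ℝ, ‖V (A (axisPt σ (R ^ (-(1 + ρ))) θ) + a)‖ ≤ ν * R)
    (hE : ∫⁻ z in Metric.closedBall (0 : EuclideanSpace ℝ (Fin 3)) (2 * R), ‖fderiv ℝ V z‖ₑ ^ 2 ≤
        ENNReal.ofReal (B * (2 * R) ^ (1 - ρ)))
    (hsmall : Λ * ((K / 2 + (1 / (2 + ρ)) * ν) * R ^ (-(2 + ρ))) ≤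
        (Λ * ((1 / (2 + ρ)) * (1 - 1 / (2 + ρ)) / 2 - lam ^ 2 / 2 - η - ν ^ 2) - (B + 4 * K ^ 2 + 4 * K)) / 2) :
    False := by
  -- ### scalars
  set γ : ℝ := 1 / (2 + ρ) with hγdef
  have h2ρ : (0 : ℝ) < 2 + ρ := by linarith
  have hγ0 : 0 < γ := one_div_pos.2 h2ρ
  have hγhalf : γ ≤ 1 / 2 := by rw [hγdef, div_le_div_iff₀ h2ρ two_pos]; linarith
  have hγ1 : 0 ≤ 1 - γ := by linarith
  have h13 : |1 - 3 * γ| ≤ 1 / 2 := abs_one_sub_three_mul_le hρ.le hρ1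
  have hR0 : 0 < R := by linarith
  set b : ℝ := R ^ (-(1 + ρ)) with hbdef
  have hb : 0 < b := Real.rpow_pos_of_pos hR0 _
  have hbR : b = R ^ (-(2 + ρ)) * R := by
    rw [hbdef, show -(1 + ρ) = -(2 + ρ) + 1 by ring, Real.rpow_add hR0, Real.rpow_one]
  have hR1ρ : R ^ (1 - ρ) = R ^ 2 * b := by
    rw [hbdef, show (1 - ρ) = (2 : ℝ) + (-(1 + ρ)) by ring, Real.rpow_add hR0, Real.rpow_two]
  have h2R : (2 * R) ^ (1 - ρ) ≤ 2 * (R ^ 2 * b) := by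
    rw [Real.mul_rpow two_pos.le hR0.le, hR1ρ]
    have h21 : (2 : ℝ) ^ (1 - ρ) ≤ 2 := by
      calc (2 : ℝ) ^ (1 - ρ) ≤ (2 : ℝ) ^ (1 : ℝ) := Real.rpow_le_rpow_of_exponent_le one_le_two (by linarith)
        _ = 2 := Real.rpow_one 2
    have h0' : 0 ≤ R ^ 2 * b := by positivity
    exact mul_le_mul_of_nonneg_right h21 h0'
  set L : ℝ := s₂ - s₁ with hLdef
  have hLΛ : Λ * b ≤ L := by rw [hLdef]; linarith
  have hL : 0 < L := lt_of_lt_of_le (mul_pos hΛ hb) hLΛ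
  have hs : s₁ < s₂ := by rw [hLdef] at hL; linarith
  -- ### the moved pair
  set V' : EuclideanSpace ℝ (Fin 3) → EuclideanSpace ℝ (Fin 3) := fun y => A.symm (V (A y + a)) with hV'def
  set P' : EuclideanSpace ℝ (Fin 3) → ℝ := fun y => P (A y + a) with hP'def
  set c' : EuclideanSpace ℝ (Fin 3) := A.symm (-a) with hc'def
  have hprof' : IsSelfSimilarEulerProfile γ c' V' P' := isSelfSimilarEulerProfile_rigid hprof A a
  have hV1 : ContDiff ℝ 1 V := hprof.contDiff_velocity.of_le (by norm_num)
  have hV'c : Continuous V' := hprof'.contDiff_velocity.continuous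
  have hP'c : Continuous P' := hprof'.contDiff_pressure.continuous
  have hnV' : ∀ x, ‖V' x‖ = ‖V (A x + a)‖ := fun x => by rw [hV'def]; exact A.symm.norm_map _
  -- points of the model cylinder
  have hmem : ∀ σ ∈ Icc s₁ s₂, ∀ t ∈ Ioc 0 b, ∀ θ : ℝ, axisPt σ t θ ∈ solidCyl s₁ s₂ b :=
    fun σ hσ t ht θ => (axisPt_mem_solidCyl ht.1.le θ).2 ⟨hσ.1, hσ.2, ht.2⟩
  -- speed on the tube, for the moved field
  have hspeed : ∀ x ∈ solidCyl s₁ s₂ b, ‖V' x‖ ≤ K * R := fun x hx => by rw [hnV' x]; exact (htube x hx).2.2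
  have hKR : 0 ≤ K * R := by positivity
  -- ### TJ-CORE for the moved pair
  have h0 := integral_axisPressureDrop_le hprof' hs hb
  -- ### (1) the left side: the ridge
  have hI : L * (((γ * (1 - γ)) / 2 - lam ^ 2 / 2 - η) * R ^ 2) ≤ ∫ σ in s₁..s₂, (P' (σ • eZ) - circleAvg P' σ b) := by
    have hpt : ∀ σ ∈ Icc s₁ s₂, ((γ * (1 - γ)) / 2 - lam ^ 2 / 2 - η) * R ^ 2 ≤ P' (σ • eZ) - circleAvg P' σ b := by
      intro σ hσ
      obtain ⟨hW, hH, hAmb, -⟩ := haxis σ hσ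
      obtain ⟨hRle, -, -⟩ := htube (σ • eZ) (smul_eZ_mem_solidCyl hσ hb.le)
      rw [selfSimilarTransport_apply, sub_zero] at hW
      simp only [selfSimilarBernoulli_apply, sub_zero] at hH
      have hW2 : ‖γ • (A (σ • eZ) + a) + V (A (σ • eZ) + a)‖ ^ 2 ≤ (lam * R) ^ 2 :=
        pow_le_pow_left₀ (norm_nonneg _) hW 2
      have hy2 : R ^ 2 ≤ ‖A (σ • eZ) + a‖ ^ 2 := pow_le_pow_left₀ hR0.le hRle 2
      have hP : P' (σ • eZ) = P (A (σ • eZ) + a) := rfl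
      rw [hP]
      have hγγ : 0 ≤ γ * (1 - γ) := mul_nonneg hγ0.le hγ1
      have hprod : γ * (1 - γ) * R ^ 2 ≤ γ * (1 - γ) * ‖A (σ • eZ) + a‖ ^ 2 := mul_le_mul_of_nonneg_left hy2 hγγ
      linarith
    have hcont : Continuous fun σ : ℝ => P' (σ • eZ) - circleAvg P' σ b :=
      (hP'c.comp (continuous_id.smul continuous_const)).sub (continuous_circleAvg_height hP'c b)
    have hm := intervalIntegral.integral_mono_on hs.le (intervalIntegrable_const (μ := volume)) (hcont.intervalIntegrable _ _) hpt
    rwa [intervalIntegral.integral_const, smul_eq_mul, show (s₂ - s₁) = L from rfl] at hm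
  -- ### (2) the Dirichlet energy of the moved cylinder
  have hEZ : ∫ x in solidCyl s₁ s₂ b, frobeniusNormSq (fderiv ℝ V' x) ≤ 6 * B * (R ^ 2 * b) := by
    have h1 := setIntegral_frobeniusNormSq_rigid_le hV1 A a (s₁ := s₁) (s₂ := s₂) (T₀ := b) (R' := 2 * R)
      (fun x hx => (htube x hx).2.1)
    have h2 := setIntegral_frobeniusNormSq_closedBall_le hV1 (by positivity : (0 : ℝ) ≤ B * (2 * R) ^ (1 - ρ)) hE
    have h3 : 3 * (B * (2 * R) ^ (1 - ρ)) ≤ 6 * B * (R ^ 2 * b) := by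
      have := mul_le_mul_of_nonneg_left h2R (by positivity : (0 : ℝ) ≤ 3 * B)
      linarith
    exact (h1.trans h2).trans h3
  -- ### (3) the end fluxes
  have heF : ∀ s ∈ Icc s₁ s₂, endFlux V' s b ≤ 2 * Real.pi * b * (K * R) ^ 2 := fun s hsI =>
    endFlux_le_of_norm_le hV'c s hb fun t ht θ => hspeed _ (hmem s hsI t ht θ)
  have heF₁ := heF s₁ ⟨le_rfl, hs.le⟩
  have heF₂ := heF s₂ ⟨hs.le, le_rfl⟩
  -- ### (4) the radial double integral
  have hJ : |∫ σ in s₁..s₂, ∫ t in (0 : ℝ)..b, circleAvg (radialVelocity V') σ t| ≤ L * b * (K * R) := by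
    have h := abs_integral_integral_circleAvg_radialVelocity_le (V := V') hs.le hb.le
      (fun σ hσ t ht θ => hspeed _ (hmem σ hσ t ht θ))
    simpa only [hLdef] using h
  have hJ' : (1 - 3 * γ) * (∫ σ in s₁..s₂, ∫ t in (0 : ℝ)..b, circleAvg (radialVelocity V') σ t) ≤ 1 / 2 * (L * b * (K * R)) :=
    calc (1 - 3 * γ) * (∫ σ in s₁..s₂, ∫ t in (0 : ℝ)..b, circleAvg (radialVelocity V') σ t)
        ≤ |(1 - 3 * γ) * (∫ σ in s₁..s₂, ∫ t in (0 : ℝ)..b, circleAvg (radialVelocity V') σ t)| := le_abs_self _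
      _ = |1 - 3 * γ| * |∫ σ in s₁..s₂, ∫ t in (0 : ℝ)..b, circleAvg (radialVelocity V') σ t| := abs_mul _ _
      _ ≤ 1 / 2 * (L * b * (K * R)) := mul_le_mul h13 hJ (abs_nonneg _) (by norm_num)
  -- ### (5) the lateral term
  have hLat : |∫ σ in s₁..s₂, circleAvg (fun y => (γ * cylRadius y + radialVelocity V' y) * radialVelocity V' y) σ b|
      ≤ L * ((γ * b + ν * R) * (ν * R)) := by
    have hνR : 0 ≤ ν * R := by positivity
    have h := intervalIntegral.norm_integral_le_of_norm_le_const (a := s₁) (b := s₂) (C := (γ * b + ν * R) * (ν * R))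
      (f := fun σ => circleAvg (fun y => (γ * cylRadius y + radialVelocity V' y) * radialVelocity V' y) σ b) fun σ hσ => by
        rw [uIoc_of_le hs.le] at hσ
        rw [Real.norm_eq_abs]
        have hw := abs_circleAvg_lateral_le (V := V') (γ := γ) (σ := σ) hb.le hνR fun θ => by
          rw [hnV']; exact (haxis σ ⟨hσ.1.le, hσ.2⟩).2.2.2 θ
        rwa [abs_of_pos hγ0] at hw
    rw [Real.norm_eq_abs, abs_of_pos (by linarith : (0 : ℝ) < s₂ - s₁)] at h
    calc |∫ σ in s₁..s₂, circleAvg (fun y => (γ * cylRadius y + radialVelocity V' y) * radialVelocity V' y) σ b|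
        ≤ (γ * b + ν * R) * (ν * R) * (s₂ - s₁) := h
      _ = L * ((γ * b + ν * R) * (ν * R)) := by rw [hLdef]; ring
  -- ### (6) the end functionals
  have htransport : ∀ x ∈ solidCyl s₁ s₂ b, |γ * (x 2 - c' 2) + axialVelocity V' x| ≤ (K + 2 * γ) * R := by
    intro x hx
    obtain ⟨-, hx2, hxV⟩ := htube x hx
    have e : γ * (x 2 - c' 2) + axialVelocity V' x = (γ • (x - c') + V' x) 2 := by
      simp only [axialVelocity, PiLp.add_apply, PiLp.smul_apply, PiLp.sub_apply, smul_eq_mul]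
    rw [e]
    calc |(γ • (x - c') + V' x) 2| ≤ ‖γ • (x - c') + V' x‖ := by
          simpa only [Real.norm_eq_abs] using PiLp.norm_apply_le (γ • (x - c') + V' x) 2
      _ = ‖γ • (A x + a) + V (A x + a)‖ := by rw [hV'def, hc'def]; exact norm_transport_rigid γ A a x
      _ ≤ ‖γ • (A x + a)‖ + ‖V (A x + a)‖ := norm_add_le _ _
      _ ≤ γ * (2 * R) + K * R := by rw [norm_smul, Real.norm_eq_abs, abs_of_pos hγ0]; gcongr
      _ = (K + 2 * γ) * R := by ring
  have hEnd : ∀ s ∈ Icc s₁ s₂, |endTermC γ c' V' b s| ≤ b * ((K + 2 * γ) * R * (K * R)) := by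
    intro s hsI
    refine abs_endTermC_le hb.le s fun t ht θ => ?_
    have hx := hmem s hsI t ht θ
    rw [abs_mul]
    exact mul_le_mul (htransport _ hx) ((abs_radialVelocity_le V' _).trans (hspeed _ hx)) (abs_nonneg _) (by positivity)
  have hOff : ∀ s ∈ Icc s₁ s₂, |offsetTerm γ c' V' b s| ≤ |γ| * b * (2 * R * (K * R)) := by
    intro s hsI
    refine abs_offsetTerm_le hb.le s fun t ht θ => ?_
    have hx := hmem s hsI t ht θ
    rw [abs_mul, ← inner_eR_eq_components c' (axisPt s t θ), abs_neg]
    -- `|⟪c′, ê_r⟫| ≤ ‖s e_z − c′‖ = ‖g(s e_z)‖ ≤ 2R`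
    have hz : ⟪(eZ : EuclideanSpace ℝ (Fin 3)), eR (axisPt s t θ)⟫ = 0 := (frame_orthonormal_axisPt s ht.1 θ).2.2.2.1
    have hc : ⟪c', eR (axisPt s t θ)⟫ = ⟪c' - s • eZ, eR (axisPt s t θ)⟫ := by
      rw [inner_sub_left, inner_smul_left, hz]; simp
    have hc2 : |⟪c', eR (axisPt s t θ)⟫| ≤ 2 * R := by
      rw [hc]
      calc |⟪c' - s • eZ, eR (axisPt s t θ)⟫| ≤ ‖c' - s • eZ‖ := abs_inner_eR_le _ _
        _ = ‖A (s • eZ) + a‖ := by rw [norm_sub_rev, hc'def]; exact norm_sub_centre_rigid A a (s • eZ)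
        _ ≤ 2 * R := (htube (s • eZ) (smul_eZ_mem_solidCyl hsI hb.le)).2.1
    exact mul_le_mul hc2 ((abs_axialVelocity_le V' _).trans (hspeed _ hx)) (abs_nonneg _) (by positivity)
  have hEnd₁ := hEnd s₁ ⟨le_rfl, hs.le⟩
  have hEnd₂ := hEnd s₂ ⟨hs.le, le_rfl⟩
  have hOff₁ := hOff s₁ ⟨le_rfl, hs.le⟩
  have hOff₂ := hOff s₂ ⟨hs.le, le_rfl⟩
  rw [abs_of_pos hγ0] at hOff₁ hOff₂
  -- ### (7) assemble: the undivided inequality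
  have h2π : (0 : ℝ) ≤ 2 * Real.pi := by positivity
  have hI2 := mul_le_mul_of_nonneg_left hI h2π
  have hJ2 := mul_le_mul_of_nonneg_left hJ' h2π
  have hLat2 := mul_le_mul_of_nonneg_left (abs_le.1 hLat).2 h2π
  have hEnds : (endTermC γ c' V' b s₂ - endTermC γ c' V' b s₁) - (offsetTerm γ c' V' b s₂ - offsetTerm γ c' V' b s₁) ≤
      2 * (b * ((K + 2 * γ) * R * (K * R))) + 2 * (γ * b * (2 * R * (K * R))) := by
    have a2 := (abs_le.1 hEnd₁).1
    have a3 := (abs_le.1 hEnd₂).2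
    have a4 := (abs_le.1 hOff₁).2
    have a5 := (abs_le.1 hOff₂).1
    linarith
  have hEnds2 := mul_le_mul_of_nonneg_left hEnds h2π
  have hsum : 2 * Real.pi * (L * (((γ * (1 - γ)) / 2 - lam ^ 2 / 2 - η) * R ^ 2)) ≤
      6 * B * (R ^ 2 * b) + 2 * (2 * Real.pi * b * (K * R) ^ 2) + 2 * Real.pi * (1 / 2 * (L * b * (K * R)))
        + 2 * Real.pi * (L * ((γ * b + ν * R) * (ν * R)))
        + 2 * Real.pi * (2 * (b * ((K + 2 * γ) * R * (K * R))) + 2 * (γ * b * (2 * R * (K * R)))) := by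
    linarith [h0, hI2, hEZ, heF₁, heF₂, hJ2, hLat2, hEnds2]
  -- ### (8) divide by `2πR²b` and conclude
  set X : ℝ := L / b with hXdef
  have hLX : L = X * b := by rw [hXdef]; field_simp
  have hXΛ : Λ ≤ X := by rw [hXdef, le_div_iff₀ hb]; exact hLΛ
  have hbdivR : b / R = R ^ (-(2 + ρ)) := by rw [hbR, mul_div_cancel_right₀ _ hR0.ne']
  have hdiv0 : X * ((γ * (1 - γ)) / 2 - lam ^ 2 / 2 - η) ≤
      3 / Real.pi * B + 4 * K ^ 2 + 8 * γ * K + X * ((K / 2 + γ * ν) * (b / R)) + X * ν ^ 2 := by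
    have hD : 0 < 2 * Real.pi * (R ^ 2 * b) := by positivity
    rw [hLX] at hsum
    have e1 : 2 * Real.pi * (X * b * (((γ * (1 - γ)) / 2 - lam ^ 2 / 2 - η) * R ^ 2)) =
        2 * Real.pi * (R ^ 2 * b) * (X * ((γ * (1 - γ)) / 2 - lam ^ 2 / 2 - η)) := by ring
    have e2 : 6 * B * (R ^ 2 * b) + 2 * (2 * Real.pi * b * (K * R) ^ 2) + 2 * Real.pi * (1 / 2 * (X * b * b * (K * R)))
        + 2 * Real.pi * (X * b * ((γ * b + ν * R) * (ν * R)))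
        + 2 * Real.pi * (2 * (b * ((K + 2 * γ) * R * (K * R))) + 2 * (γ * b * (2 * R * (K * R)))) =
        2 * Real.pi * (R ^ 2 * b) * (3 / Real.pi * B + 4 * K ^ 2 + 8 * γ * K + X * ((K / 2 + γ * ν) * (b / R)) + X * ν ^ 2) := by
      field_simp
      ring
    rw [e1, e2] at hsum
    exact le_of_mul_le_mul_left hsum hD
  set ε₀ : ℝ := (K / 2 + γ * ν) * R ^ (-(2 + ρ)) with hε₀def
  have hdiv : X * ((γ * (1 - γ)) / 2 - lam ^ 2 / 2 - η) ≤
      3 / Real.pi * B + 4 * K ^ 2 + 8 * γ * K + X * ε₀ + X * ν ^ 2 := by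
    rw [hε₀def, ← hbdivR]; exact hdiv0
  have hπ : 0 < Real.pi := Real.pi_pos
  have h3π : 3 / Real.pi * B ≤ B := by
    have h31 : 3 / Real.pi ≤ 1 := by rw [div_le_one hπ]; exact Real.pi_gt_three.le
    have := mul_le_mul_of_nonneg_right h31 hB
    linarith
  have h8γ : 8 * γ * K ≤ 4 * K := by
    have := mul_le_mul_of_nonneg_right hγhalf hK
    linarith
  have hX : X * ((γ * (1 - γ)) / 2 - lam ^ 2 / 2 - η - ν ^ 2 - ε₀) ≤ B + 4 * K ^ 2 + 4 * K := by linarith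
  have hS0 : 0 ≤ B + 4 * K ^ 2 + 4 * K := by positivity
  have hΛle : Λ * ((γ * (1 - γ)) / 2 - lam ^ 2 / 2 - η - ν ^ 2 - ε₀) ≤ B + 4 * K ^ 2 + 4 * K := by
    by_cases hpos : 0 ≤ (γ * (1 - γ)) / 2 - lam ^ 2 / 2 - η - ν ^ 2 - ε₀
    · exact (mul_le_mul_of_nonneg_right hXΛ hpos).trans hX
    · exact (mul_nonpos_iff.2 (Or.inl ⟨hΛ.le, (not_le.1 hpos).le⟩)).trans hS0
  -- the face and the largeness of `R`
  have hface' : B + 4 * K ^ 2 + 4 * K < Λ * (γ * (1 - γ) / 2 - lam ^ 2 / 2 - η - ν ^ 2) := by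
    simpa only [hγdef] using hface
  have hsmall' : Λ * ε₀ ≤ (Λ * (γ * (1 - γ) / 2 - lam ^ 2 / 2 - η - ν ^ 2) - (B + 4 * K ^ 2 + 4 * K)) / 2 := by
    simpa only [hγdef, hε₀def] using hsmall
  linarith [hΛle, hface', hsmall']

end Summit.NavierStokesRegularity.NavierStokesRegularity.Theorems.PowerGaugeEulerLiouville.HoopCore

end
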